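import Summits.ResolutionOfSingularities.ResolutionOfSingularities.Theorems.FrobeniusClosingPatchingRelPerfectMonomialPolyhedraGameMarked
import Literature.AlgebraicGeometry.Resolution.KollarBlowupSequenceFunctorsProofs
import Literature.AlgebraicGeometry.Resolution.KollarTripleEtaleCover
import Literature.AlgebraicGeometry.Resolution.AffineBlowupCartier
import Literature.AlgebraicGeometry.Resolution.KollarFunctorLinearCentre
import Literature.AlgebraicGeometry.Resolution.ProjectiveSpaceRegular
import Mathlib.AlgebraicGeometry.Morphisms.QuasiSeparated
import Mathlib.RingTheory.MvPolynomial.Basic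
import HarnessLib

/-!
# Crux `PatchingRelPerfect` (stmt-ResolutionOfSingularities-16161), chain w52 — TargetsF3 (m)
# «M2-strong», COMBINATORIAL HALF, Route K step K1: REALISATION of a game state as a Kollár
# triple over `ℚ`, and step K2: the functorial order-reduction sequence on it

[OURS · L1 W5.2 · res-L1-w52-plan-1 RULING «Route K approved» 07:37:28Z; fact-free; nothing here is a
statement of the manuscript under review]

For a well-formed state `s = (B, Str, A)` of the permissible polyhedra game (file 1) with a
non-empty stratum complex, the TORIC REALISATION over `ℚ` is

* the polynomial ring `R_B = ℚ[x_b : b ∈ B]` (`MvPolynomial ↥B ℚ`),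
* the open subscheme `X_s = ⋃_{T ∈ Str} D(m_T) ⊆ 𝔸^B_ℚ`, `m_T = ∏_{b ∉ T} x_b` — the points whose
  set of vanishing coordinates is a stratum (`Str` is down-closed), i.e. `𝔸^B` minus the closed
  coordinate strata not in `Str`;
* the monomial ideal `I_s = (x^α : α ∈ A)` restricted to `X_s`.

`X_s` is integral, regular, quasi-compact and of finite type over `ℚ`, and `I_s ≠ 0`, so
`(X_s, I_s, ∅)` is a triple of Kollár's Notation 3.64 in some dimension (`realisation`), and the
tree's PROVED functorial order reduction in characteristic zero
(`Kollar2007Thm3_103.orderReduction Kollar2007Thm3_103_holds Kollar2007Thm3_107_holds`) provides,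
for every marking `m ≥ 1`, a blow-up sequence functor resolving `(X_s, I_s, m, ∅)` and commuting with
smooth morphisms (`exists_functorial_resolution`).  Steps K3 (the centres are closed strata: torus
stability via functoriality + `…MonomialScalingStableIdeal` + toroidal atlas), K4 (stratum-step
dictionary) and K5 (assembly into `RouteKTarget m`) follow in later files.
-/

-- `Summit.<Summit>.<Sub>.Theorems` with `Sub = Summit` (single-conjunct summit, D-0017)
set_option linter.dupNamespace false

noncomputable section

open CategoryTheory AlgebraicGeometry MvPolynomial Literature.AlgebraicGeometry.Resolution

namespace Summit.ResolutionOfSingularities.ResolutionOfSingularities.Theorems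

namespace PolyhedraGame

namespace RouteK

/-! ## The ring, the monomials, the open subscheme -/

/-- [OURS] The coordinate ring `ℚ[x_b : b ∈ B]` of the realisation. -/
abbrev R (B : Finset ℕ) : Type := MvPolynomial B ℚ

/-- [OURS] The affine space `𝔸^B_ℚ = Spec ℚ[x_B]`. -/
abbrev affine (B : Finset ℕ) : Scheme := Spec (.of (R B))

/-- [OURS] The monomial `m_T = ∏_{b ∈ B ∖ T} x_b` whose non-vanishing locus `D(m_T)` is the set of points
whose vanishing coordinates all lie in `T`. -/
def coMonomial (B T : Finset ℕ) : R B := ∏ b ∈ B.attach with b.1 ∉ T, X b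

/-- [OURS] The exponent vector of `α : ℕ →₀ ℕ` on the variables indexed by `B`. -/
def expOn (B : Finset ℕ) (α : ℕ →₀ ℕ) : B →₀ ℕ := α.subtypeDomain (· ∈ B)

/-- [OURS] The monomial `x^α` of the realisation. -/
def genMonomial (B : Finset ℕ) (α : ℕ →₀ ℕ) : R B := monomial (expOn B α) 1

/-- [OURS] The monomial ideal `(x^α : α ∈ A)` of `ℚ[x_B]`. -/
def genIdeal (s : State) : Ideal (R s.B) := Ideal.span ((genMonomial s.B) '' (s.A : Set (ℕ →₀ ℕ)))

/-- [OURS] The open `X_s = ⋃_{T ∈ Str} D(m_T)` of `𝔸^B_ℚ`. -/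
def stateOpen (s : State) : (affine s.B).Opens :=
  ⨆ T : s.Str, PrimeSpectrum.basicOpen (coMonomial s.B T.1)

/-- [OURS] The realised scheme `X_s` (an open subscheme of `𝔸^B_ℚ`). -/
abbrev X (s : State) : Scheme := (stateOpen s : Scheme)

/-- [OURS] The structure morphism `X_s → Spec ℚ`. -/
def struct (s : State) : X s ⟶ Spec (.of ℚ) :=
  (stateOpen s).ι ≫ Spec.map (CommRingCat.ofHom (algebraMap ℚ (R s.B)))

/-- [OURS] The realised ideal sheaf `I_s` on `X_s`. -/
def ideal (s : State) : (X s).IdealSheafData :=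
  (affineBlowup.idealSheaf (genIdeal s)).comap (stateOpen s).ι

/-! ## Basic properties -/

/-- [OURS] `m_T ≠ 0`. -/
theorem coMonomial_ne_zero (B T : Finset ℕ) : coMonomial B T ≠ 0 := by
  unfold coMonomial
  exact Finset.prod_ne_zero_iff.mpr fun b _ => X_ne_zero b

/-- [OURS] `x^α ≠ 0`. -/
theorem genMonomial_ne_zero (B : Finset ℕ) (α : ℕ →₀ ℕ) : genMonomial B α ≠ 0 := by
  unfold genMonomial
  exact monomial_eq_zero.not.mpr one_ne_zero

/-- [OURS] The monomial ideal of a well-formed state is non-zero. -/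
theorem genIdeal_ne_bot {s : State} (hs : s.WF) : genIdeal s ≠ ⊥ := by
  obtain ⟨α, hα⟩ := hs.nonempty
  intro h
  have : genMonomial s.B α ∈ genIdeal s := Ideal.subset_span ⟨α, hα, rfl⟩
  rw [h, Ideal.mem_bot] at this
  exact genMonomial_ne_zero s.B α this

/-- [OURS] The generic point of `𝔸^B` (the zero prime) lies in every `D(m_T)`, hence in `X_s` as soon
as there is a stratum. -/
theorem stateOpen_nonempty {s : State} (hne : s.Str.Nonempty) : Nonempty (X s) := by
  obtain ⟨T, hT⟩ := hne
  let η : affine s.B := (⟨⊥, Ideal.isPrime_bot⟩ : PrimeSpectrum (R s.B))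
  have hη : η ∈ stateOpen s := by
    unfold stateOpen
    refine TopologicalSpace.Opens.mem_iSup.mpr ⟨⟨T, hT⟩, ?_⟩
    exact (show coMonomial s.B T ∉ (⊥ : Ideal (R s.B)) from by
      rw [Ideal.mem_bot]; exact coMonomial_ne_zero s.B T)
  exact ⟨⟨η, hη⟩⟩

/-- [OURS] `X_s` is an integral scheme (a non-empty open of the integral `𝔸^B_ℚ`). -/
theorem isIntegral_X {s : State} (hne : s.Str.Nonempty) : IsIntegral (X s) := by
  haveI := stateOpen_nonempty hne
  exact isIntegral_of_isOpenImmersion (stateOpen s).ι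

/-- [OURS] `X_s` is a regular scheme. -/
theorem isRegular_X (s : State) : Scheme.IsRegular (X s) := by
  haveI : IsRegularRing (CommRingCat.of (R s.B)) := inferInstanceAs (IsRegularRing (R s.B))
  exact Scheme.IsRegular.of_isOpenImmersion (stateOpen s).ι (Scheme.isRegular_Spec _)

/-- [OURS] `X_s` is quasi-compact as a subset of `𝔸^B` (a finite union of basic opens). -/
theorem isCompact_stateOpen (s : State) : IsCompact ((stateOpen s : (affine s.B).Opens) : Set (affine s.B)) := by
  have h : ((stateOpen s : (affine s.B).Opens) : Set (affine s.B)) =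
      ⋃ T : s.Str, {x : affine s.B | coMonomial s.B T.1 ∉ x.asIdeal} := by
    ext x
    simp only [stateOpen, SetLike.mem_coe, Set.mem_iUnion, Set.mem_setOf_eq]
    exact TopologicalSpace.Opens.mem_iSup
  rw [h]
  exact isCompact_iUnion fun T => PrimeSpectrum.isCompact_basicOpen (coMonomial s.B T.1)

/-- [OURS] `X_s` is a quasi-compact scheme. -/
theorem compactSpace_X (s : State) : CompactSpace (X s) :=
  isCompact_iff_compactSpace.mp (isCompact_stateOpen s)

/-- [OURS] The structure morphism is locally of finite type. -/
instance locallyOfFiniteType_struct (s : State) : LocallyOfFiniteType (struct s) := by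
  unfold struct
  haveI : LocallyOfFiniteType (Spec.map (CommRingCat.ofHom (algebraMap ℚ (R s.B)))) := by
    rw [HasRingHomProperty.Spec_iff (P := @LocallyOfFiniteType), CommRingCat.hom_ofHom]
    exact RingHom.finiteType_algebraMap.mpr inferInstance
  infer_instance

/-- [OURS] The structure morphism is quasi-compact. -/
instance quasiCompact_struct (s : State) : QuasiCompact (struct s) := by
  haveI := compactSpace_X s
  exact (quasiCompact_iff_compactSpace (struct s)).mpr inferInstance

/-- [OURS] The realised ideal sheaf is non-zero (when there is a stratum). -/
theorem ideal_ne_bot {s : State} (hs : s.WF) (hne : s.Str.Nonempty) : ideal s ≠ ⊥ := by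
  haveI := stateOpen_nonempty hne
  obtain ⟨x⟩ := (inferInstance : Nonempty (X s))
  intro h
  have h0 : affineBlowup.idealSheaf (genIdeal s) ≠ ⊥ :=
    fun h' => genIdeal_ne_bot hs (affineBlowup.idealSheaf_eq_bot_iff.mp h')
  have h1 : stalkIdeal (ideal s) x ≠ ⊥ :=
    stalkIdeal_comap_ne_bot (stateOpen s).ι (stalkIdeal_ne_bot_of_ne_bot h0 ((stateOpen s).ι x))
  rw [h, stalkIdeal_bot] at h1
  exact h1 rfl

/-! ## K1: the triple; K2: the functorial resolution sequence -/

/-- [OURS] `X_s` is equidimensional of some dimension (it is integral of finite type over `ℚ`). -/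
theorem exists_dim {s : State} (hne : s.Str.Nonempty) :
    ∃ n : ℕ, ∀ Z ∈ irreducibleComponents (X s), topologicalKrullDim Z = n := by
  haveI := isIntegral_X hne
  exact exists_equidim_of_isIntegral (struct s)

/-- [OURS] The dimension of the realisation (a choice of the `n` of `exists_dim`; it is `#B`, not
needed here). -/
def dim (s : State) (hne : s.Str.Nonempty) : ℕ := Classical.choose (exists_dim hne)

/-- [OURS · Route K, step K1] **The realisation of a well-formed state with a stratum as a Kollár triple
`(X_s, I_s, ∅)` over `ℚ`** (Notation 3.64: regular, equidimensional, of finite type, `I ≠ 0` on every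
component, empty ordered boundary). -/
def triple (s : State) (hs : s.WF) (hne : s.Str.Nonempty) : Kollar2007.Triple ℚ (dim s hne) :=
  haveI := isIntegral_X hne
  { X := X s, struct := struct s, isRegular := isRegular_X s,
    equidim := Classical.choose_spec (exists_dim hne), ideal := ideal s,
    stalkIdeal_ne_bot := stalkIdeal_ne_bot_of_ne_bot (ideal_ne_bot hs hne), boundary := [],
    hasSNC := hasSNC_nil_of_isRegular (isRegular_X s), boundary_pairwise := List.Pairwise.nil }

/-- [OURS] Unfolding: the scheme of the realised triple. -/
@[simp] theorem triple_X (s : State) (hs : s.WF) (hne : s.Str.Nonempty) :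
    (triple s hs hne).X = X s := rfl

/-- [OURS] Unfolding: the ideal of the realised triple. -/
@[simp] theorem triple_ideal (s : State) (hs : s.WF) (hne : s.Str.Nonempty) :
    (triple s hs hne).ideal = ideal s := rfl

/-- [OURS] Unfolding: the realised triple has empty boundary. -/
@[simp] theorem triple_boundary (s : State) (hs : s.WF) (hne : s.Str.Nonempty) :
    (triple s hs hne).boundary = [] := rfl

/-- [OURS] Unfolding: the structure morphism of the realised triple. -/
@[simp] theorem triple_struct (s : State) (hs : s.WF) (hne : s.Str.Nonempty) :
    (triple s hs hne).struct = struct s := rfl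

/-- [OURS · Route K, step K2] **The functorial order-reduction sequence of the realisation**: for every
marking `m ≥ 1` there is a blow-up sequence FUNCTOR `B` on triples of dimension `dim s` over
characteristic-zero fields which resolves every marked triple `(X, I, m, E)` without empty centres and
COMMUTES WITH SMOOTH MORPHISMS (Kollár 3.34.1) and with change of fields — from the tree's PROVED
Thms. 3.103 / 3.107 (`Kollar2007Thm3_103.orderReduction`); in particular `B (triple s)` is a resolution of
`(X_s, I_s, m, ∅)`: regular centres inside `cosupp (I_i, m)`, ending with `cosupp (I_r, m) = ∅`. -/
theorem exists_functorial_resolution (s : State) (hs : s.WF) (hne : s.Str.Nonempty) {m : ℕ}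
    (hm : 1 ≤ m) :
    ∃ B : Kollar2007.BlowupSequenceFunctor (dim s hne),
      (B (triple s hs hne)).IsResolutionOf ((triple s hs hne).marked m) ∧
      (B (triple s hs hne)).NoEmptyCentres ∧
      (∀ ⦃k : Type⦄ [Field k] [CharZero k] (T : Kollar2007.Triple k (dim s hne)),
        (B T).IsResolutionOf (T.marked m) ∧ (B T).NoEmptyCentres) ∧
      Kollar2007.CommutesWithSmoothMorphisms (Kollar2007.TripleClass.all (dim s hne)) B ∧
      Kollar2007.CommutesWithFieldChange (Kollar2007.TripleClass.all (dim s hne)) B := by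
  obtain ⟨B, hB, hcomm, hfield, -⟩ :=
    (Kollar2007Thm3_103_holds.orderReduction Kollar2007Thm3_107_holds (dim s hne)).2 m hm
  exact ⟨B, (hB _).1, (hB _).2, hB, hcomm, hfield⟩

end RouteK


end PolyhedraGame

end Summit.ResolutionOfSingularities.ResolutionOfSingularities.Theorems

end
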